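import Summits.QuantumFields.YangMills.Theorems.ColdStartUniversalityLatticeLangevinWilsonReversible
import HarnessLib

/-!
# Route `ColdStartUniversality` (fixed-cut-off package): reversibility of the SU(2) lattice Langevin dynamics w.r.t. the
# Wilson measure — bounded measurable observables, and positivity `⟨F, P_t F⟩_μ = ‖P_{t/2} F‖² ≥ 0`

Helper file (seat `ym-line-csu-p1`, g15).  Consequences of `integral_mul_transition_symm_su2` (detailed balance of the
Shen–Zhu–Zhu semigroup on continuous observables, SZZ CMP 400 (2023) §3 p. 13) for the SU(2) system on `(ℤ/L)³` at any
coupling `β'`, any lattice time `t`, any Markov kernel family `κ` realising the transition laws: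

* `integral_transitionKernel_integral_eq_wilson` — invariance in kernel form on bounded measurable observables
  (`∫ κ_t h dμ_{β'} = ∫ h dμ_{β'}`, from `wilsonMeasureLangevinInvariant_su2`);
* `abs_symmDefect_sub_le` — the symmetry defect `∫ F κ_t G dμ - ∫ G κ_t F dμ` is `2 sup|F|`-Lipschitz in `G` for the
  `L¹(μ_{β'})` distance (invariance), hence
* ★ `integral_mul_transition_symm_su2_of_measurable` — detailed balance `∫ F κ_t G dμ_{β'} = ∫ G κ_t F dμ_{β'}` for all BOUNDED
  MEASURABLE `F, G` (density of bounded continuous functions in `L¹`, `Integrable.exists_boundedContinuous_integral_sub_le`);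
* ★ `integral_mul_transition_self_nonneg` — POSITIVITY: `∫ F · κ_t F dμ_{β'} = ∫ (κ_{t/2} F)² dμ_{β'} ≥ 0` for continuous `F`
  (Chapman–Kolmogorov + symmetry), i.e. `P_t = P_{t/2}* P_{t/2} ≥ 0` on `L²(μ_{β'})`.

THEOREMS ONLY, no definition, no sorry.  RECORD-rung R3 plumbing (fixed cut-off); this is not the K-uniform crux and the
Yang–Mills mass gap is NOT proved.
-/

set_option autoImplicit false

noncomputable section

namespace Summit.QuantumFields.YangMills.Theorems.ColdStartUniversality

open MeasureTheory ProbabilityTheory Finset Filter Set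
open scoped BigOperators NNReal ENNReal
open Literature.Probability.Process Literature.MathematicalPhysics.QuantumFieldTheory Literature.Analysis.SpecialFunctions
open Literature.MathematicalPhysics.QuantumLattice (fundamentalRep fundamentalLatticeRep continuous_fundamentalRep)

variable {L : ℕ} [NeZero L]

/-- **Invariance in kernel form on bounded measurable observables**: `∫ (∫ h dκ_t x) dμ_{β'}(x) = ∫ h dμ_{β'}` (SZZ Lemma 3.3,
`wilsonMeasureLangevinInvariant_su2`, read through `wilson_invariant_of_fact`).
[cite: ShenZhuZhu2022, §3 Lemma 3.3 (invariance of the lattice Yang–Mills measure; p. 13)] -/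
theorem integral_transitionKernel_integral_eq_wilson (β' : ℝ)
    (κ : ℝ≥0 → Kernel (GaugeConfig 3 L (Matrix.specialUnitaryGroup (Fin 2) ℂ))
      (GaugeConfig 3 L (Matrix.specialUnitaryGroup (Fin 2) ℂ))) [∀ t, IsMarkovKernel (κ t)]
    (hreal : ∀ (t : ℝ≥0) (x : GaugeConfig 3 L (Matrix.specialUnitaryGroup (Fin 2) ℂ))
        (Ω : Type) [MeasurableSpace Ω] (P : Measure Ω) [IsProbabilityMeasure P]
        (W : ℝ≥0 → Ω → (Edge 3 L × NoiseIdx 2 → ℝ)) (hW : IsFlatBrownian W P)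
        (U : ℝ≥0 → Ω → GaugeConfig 3 L (Matrix.specialUnitaryGroup (Fin 2) ℂ)),
        (∀ ω, U 0 ω = x) →
        (latticeLangevinDynamics (fundamentalLatticeRep 2) β').IsSolution (fundamentalRep (Fin 2))
          hW.natFiltration P W U →
        κ t x = P.map (U t))
    (t : ℝ≥0) {h : GaugeConfig 3 L (Matrix.specialUnitaryGroup (Fin 2) ℂ) → ℝ} (hm : Measurable h)
    (hb : ∃ C : ℝ, ∀ x, |h x| ≤ C) :
    ∫ x, (∫ y, h y ∂(κ t x)) ∂(wilsonMeasure (d := 3) (L := L) (fundamentalRep (Fin 2)) β') =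
      ∫ x, h x ∂(wilsonMeasure (d := 3) (L := L) (fundamentalRep (Fin 2)) β') := by
  classical
  haveI := secondCountableTopology_su2
  haveI := borelSpace_config L
  haveI : IsProbabilityMeasure (wilsonMeasure (d := 3) (L := L) (fundamentalRep (Fin 2)) β') :=
    isProbabilityMeasure_wilsonMeasure (d := 3) (L := L) (fundamentalRep (Fin 2)) (continuous_fundamentalRep (Fin 2)) β'
  have hinv : Kernel.Invariant (κ t) (wilsonMeasure (d := 3) (L := L) (fundamentalRep (Fin 2)) β') :=
    wilson_invariant_of_fact L β' (wilsonMeasureLangevinInvariant_su2 L β') κ hreal t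
  obtain ⟨C, hC⟩ := hb
  have hfi : Integrable h ((κ t) ∘ₘ wilsonMeasure (d := 3) (L := L) (fundamentalRep (Fin 2)) β') :=
    (integrable_const C).mono' hm.aestronglyMeasurable (ae_of_all _ fun y => by rw [Real.norm_eq_abs]; exact hC y)
  have hcomp : ∫ y, h y ∂((κ t) ∘ₘ wilsonMeasure (d := 3) (L := L) (fundamentalRep (Fin 2)) β') =
      ∫ x, ∫ y, h y ∂(κ t x) ∂(wilsonMeasure (d := 3) (L := L) (fundamentalRep (Fin 2)) β') := by
    rw [Measure.comp_eq_comp_const_apply] at hfi ⊢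
    rw [Kernel.integral_comp hfi, Kernel.const_apply]
  rw [← hcomp]
  exact congrArg (fun ν => ∫ y, h y ∂ν) hinv.def

/-- **The symmetry defect is `L¹(μ)`-Lipschitz in the second observable**: for bounded measurable `F, G, G'` with
`|F| ≤ M`, `|(∫ F κ_t G dμ - ∫ G κ_t F dμ) - (∫ F κ_t G' dμ - ∫ G' κ_t F dμ)| ≤ 2 M ∫ |G - G'| dμ` (`μ = μ_{β'}`; the second term
uses the invariance of `μ` under `κ_t`). [folklore] -/
theorem abs_symmDefect_sub_le (β' : ℝ)
    (κ : ℝ≥0 → Kernel (GaugeConfig 3 L (Matrix.specialUnitaryGroup (Fin 2) ℂ))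
      (GaugeConfig 3 L (Matrix.specialUnitaryGroup (Fin 2) ℂ))) [∀ t, IsMarkovKernel (κ t)]
    (hreal : ∀ (t : ℝ≥0) (x : GaugeConfig 3 L (Matrix.specialUnitaryGroup (Fin 2) ℂ))
        (Ω : Type) [MeasurableSpace Ω] (P : Measure Ω) [IsProbabilityMeasure P]
        (W : ℝ≥0 → Ω → (Edge 3 L × NoiseIdx 2 → ℝ)) (hW : IsFlatBrownian W P)
        (U : ℝ≥0 → Ω → GaugeConfig 3 L (Matrix.specialUnitaryGroup (Fin 2) ℂ)),
        (∀ ω, U 0 ω = x) →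
        (latticeLangevinDynamics (fundamentalLatticeRep 2) β').IsSolution (fundamentalRep (Fin 2))
          hW.natFiltration P W U →
        κ t x = P.map (U t))
    (t : ℝ≥0) {F G G' : GaugeConfig 3 L (Matrix.specialUnitaryGroup (Fin 2) ℂ) → ℝ}
    (hFm : Measurable F) {M : ℝ} (hM : ∀ x, |F x| ≤ M) (hGm : Measurable G) (hGb : ∃ C : ℝ, ∀ x, |G x| ≤ C)
    (hG'm : Measurable G') (hG'b : ∃ C : ℝ, ∀ x, |G' x| ≤ C) :
    |((∫ x, F x * (∫ y, G y ∂(κ t x)) ∂(wilsonMeasure (d := 3) (L := L) (fundamentalRep (Fin 2)) β')) -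
        ∫ x, G x * (∫ y, F y ∂(κ t x)) ∂(wilsonMeasure (d := 3) (L := L) (fundamentalRep (Fin 2)) β')) -
      ((∫ x, F x * (∫ y, G' y ∂(κ t x)) ∂(wilsonMeasure (d := 3) (L := L) (fundamentalRep (Fin 2)) β')) -
        ∫ x, G' x * (∫ y, F y ∂(κ t x)) ∂(wilsonMeasure (d := 3) (L := L) (fundamentalRep (Fin 2)) β'))| ≤
      2 * M * ∫ x, |G x - G' x| ∂(wilsonMeasure (d := 3) (L := L) (fundamentalRep (Fin 2)) β') := by
  classical
  haveI := secondCountableTopology_su2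
  haveI := borelSpace_config L
  set μ : Measure (GaugeConfig 3 L (Matrix.specialUnitaryGroup (Fin 2) ℂ)) :=
    wilsonMeasure (d := 3) (L := L) (fundamentalRep (Fin 2)) β' with hμ
  haveI : IsProbabilityMeasure μ :=
    isProbabilityMeasure_wilsonMeasure (d := 3) (L := L) (fundamentalRep (Fin 2)) (continuous_fundamentalRep (Fin 2)) β'
  obtain ⟨CG, hCG⟩ := hGb
  obtain ⟨CG', hCG'⟩ := hG'b
  have hM0 : 0 ≤ M := (abs_nonneg _).trans (hM (Classical.arbitrary _))
  -- bounded measurable functions are integrable against every probability measure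
  have hint : ∀ {u : GaugeConfig 3 L (Matrix.specialUnitaryGroup (Fin 2) ℂ) → ℝ} {C : ℝ}, Measurable u → (∀ x, |u x| ≤ C) →
      ∀ (ν : Measure (GaugeConfig 3 L (Matrix.specialUnitaryGroup (Fin 2) ℂ))) [IsProbabilityMeasure ν], Integrable u ν :=
    fun hu hC ν _ => (integrable_const _).mono' hu.aestronglyMeasurable
      (ae_of_all _ fun y => by rw [Real.norm_eq_abs]; exact hC y)
  -- kernel averages: measurability and bounds
  have hker_m : ∀ {u : GaugeConfig 3 L (Matrix.specialUnitaryGroup (Fin 2) ℂ) → ℝ}, Measurable u →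
      Measurable fun x => ∫ y, u y ∂(κ t x) := fun hu => (hu.stronglyMeasurable.integral_kernel (κ := κ t)).measurable
  have hker_bd : ∀ {u : GaugeConfig 3 L (Matrix.specialUnitaryGroup (Fin 2) ℂ) → ℝ} {C : ℝ}, (∀ y, |u y| ≤ C) →
      ∀ x, |∫ y, u y ∂(κ t x)| ≤ C := fun hC x => abs_integral_le_of_abs_le_of_isProbabilityMeasure hC
  -- the differences
  have hDm : Measurable fun x => G x - G' x := hGm.sub hG'm
  have hDb : ∀ x, |G x - G' x| ≤ CG + CG' := fun x => (abs_sub _ _).trans (add_le_add (hCG x) (hCG' x))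
  have hDi : Integrable (fun x => G x - G' x) μ := hint hDm hDb μ
  have hDabs_i : Integrable (fun x => |G x - G' x|) μ := hDi.abs
  -- first difference: `∫ F κ(G - G') dμ`
  have hκD : ∀ x, (∫ y, G y ∂(κ t x)) - ∫ y, G' y ∂(κ t x) = ∫ y, (G y - G' y) ∂(κ t x) := fun x =>
    (integral_sub (hint hGm hCG _) (hint hG'm hCG' _)).symm
  have i1 : Integrable (fun x => F x * ∫ y, G y ∂(κ t x)) μ :=
    hint (u := fun x => F x * ∫ y, G y ∂(κ t x)) (hFm.mul (hker_m hGm)) (C := M * CG) (fun x => by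
      rw [abs_mul]; exact mul_le_mul (hM x) (hker_bd hCG x) (abs_nonneg _) hM0) μ
  have i1' : Integrable (fun x => F x * ∫ y, G' y ∂(κ t x)) μ :=
    hint (u := fun x => F x * ∫ y, G' y ∂(κ t x)) (hFm.mul (hker_m hG'm)) (C := M * CG') (fun x => by
      rw [abs_mul]; exact mul_le_mul (hM x) (hker_bd hCG' x) (abs_nonneg _) hM0) μ
  have i2 : Integrable (fun x => G x * ∫ y, F y ∂(κ t x)) μ :=
    hint (u := fun x => G x * ∫ y, F y ∂(κ t x)) (hGm.mul (hker_m hFm)) (C := CG * M) (fun x => by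
      rw [abs_mul]
      exact mul_le_mul (hCG x) (hker_bd hM x) (abs_nonneg _) ((abs_nonneg _).trans (hCG x))) μ
  have i2' : Integrable (fun x => G' x * ∫ y, F y ∂(κ t x)) μ :=
    hint (u := fun x => G' x * ∫ y, F y ∂(κ t x)) (hG'm.mul (hker_m hFm)) (C := CG' * M) (fun x => by
      rw [abs_mul]
      exact mul_le_mul (hCG' x) (hker_bd hM x) (abs_nonneg _) ((abs_nonneg _).trans (hCG' x))) μ
  have e1 : (∫ x, F x * (∫ y, G y ∂(κ t x)) ∂μ) - ∫ x, F x * (∫ y, G' y ∂(κ t x)) ∂μ =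
      ∫ x, F x * ∫ y, (G y - G' y) ∂(κ t x) ∂μ := by
    rw [← integral_sub i1 i1']
    exact integral_congr_ae (Eventually.of_forall fun x => by dsimp only; rw [← hκD x, mul_sub])
  have e2 : (∫ x, G x * (∫ y, F y ∂(κ t x)) ∂μ) - ∫ x, G' x * (∫ y, F y ∂(κ t x)) ∂μ =
      ∫ x, (G x - G' x) * ∫ y, F y ∂(κ t x) ∂μ := by
    rw [← integral_sub i2 i2']
    exact integral_congr_ae (Eventually.of_forall fun x => by dsimp only; rw [sub_mul])
  -- bounds
  have hκabs_m : Measurable fun x => ∫ y, |G y - G' y| ∂(κ t x) := hker_m hDm.abs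
  have hκabs_i : Integrable (fun x => ∫ y, |G y - G' y| ∂(κ t x)) μ :=
    hint (u := fun x => ∫ y, |G y - G' y| ∂(κ t x)) hκabs_m (C := CG + CG') (fun x => by
      show |∫ y, |G y - G' y| ∂(κ t x)| ≤ CG + CG'
      rw [abs_of_nonneg (integral_nonneg fun y => abs_nonneg _)]
      have h := hker_bd (u := fun y => |G y - G' y|) (fun y => by rw [abs_abs]; exact hDb y) x
      rwa [abs_of_nonneg (integral_nonneg fun y => abs_nonneg _)] at h) μ
  have b1 : |∫ x, F x * ∫ y, (G y - G' y) ∂(κ t x) ∂μ| ≤ M * ∫ x, |G x - G' x| ∂μ := by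
    calc |∫ x, F x * ∫ y, (G y - G' y) ∂(κ t x) ∂μ| ≤ ∫ x, |F x * ∫ y, (G y - G' y) ∂(κ t x)| ∂μ :=
          abs_integral_le_integral_abs
      _ ≤ ∫ x, M * ∫ y, |G y - G' y| ∂(κ t x) ∂μ := by
          refine integral_mono_of_nonneg (ae_of_all _ fun x => abs_nonneg _) (hκabs_i.const_mul M)
            (ae_of_all _ fun x => ?_)
          dsimp only
          rw [abs_mul]
          exact mul_le_mul (hM x) (abs_integral_le_integral_abs) (abs_nonneg _) hM0
      _ = M * ∫ x, |G x - G' x| ∂μ := by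
          rw [integral_const_mul]
          congr 1
          exact integral_transitionKernel_integral_eq_wilson (L := L) β' κ hreal t hDm.abs
            ⟨CG + CG', fun y => by rw [abs_abs]; exact hDb y⟩
  have b2 : |∫ x, (G x - G' x) * ∫ y, F y ∂(κ t x) ∂μ| ≤ M * ∫ x, |G x - G' x| ∂μ := by
    calc |∫ x, (G x - G' x) * ∫ y, F y ∂(κ t x) ∂μ| ≤ ∫ x, |(G x - G' x) * ∫ y, F y ∂(κ t x)| ∂μ :=
          abs_integral_le_integral_abs
      _ ≤ ∫ x, M * |G x - G' x| ∂μ := by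
          refine integral_mono_of_nonneg (ae_of_all _ fun x => abs_nonneg _) (hDabs_i.const_mul M)
            (ae_of_all _ fun x => ?_)
          dsimp only
          rw [abs_mul, mul_comm]
          exact mul_le_mul (hker_bd hM x) le_rfl (abs_nonneg _) hM0
      _ = M * ∫ x, |G x - G' x| ∂μ := integral_const_mul _ _
  have hsplit : ((∫ x, F x * (∫ y, G y ∂(κ t x)) ∂μ) - ∫ x, G x * (∫ y, F y ∂(κ t x)) ∂μ) -
      ((∫ x, F x * (∫ y, G' y ∂(κ t x)) ∂μ) - ∫ x, G' x * (∫ y, F y ∂(κ t x)) ∂μ) =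
      (∫ x, F x * ∫ y, (G y - G' y) ∂(κ t x) ∂μ) - ∫ x, (G x - G' x) * ∫ y, F y ∂(κ t x) ∂μ := by
    rw [← e1, ← e2]; ring
  rw [hsplit]
  calc _ ≤ |∫ x, F x * ∫ y, (G y - G' y) ∂(κ t x) ∂μ| + |∫ x, (G x - G' x) * ∫ y, F y ∂(κ t x) ∂μ| := abs_sub _ _
    _ ≤ M * (∫ x, |G x - G' x| ∂μ) + M * ∫ x, |G x - G' x| ∂μ := add_le_add b1 b2
    _ = 2 * M * ∫ x, |G x - G' x| ∂μ := by ring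

/-- ★ **Detailed balance on bounded measurable observables**: for every Markov kernel family realising the transition laws
of the SU(2) SZZ system at coupling `β'`, every lattice time `t` and all BOUNDED MEASURABLE `F, G : SU(2)^E → ℝ`,
`∫ F(x) (∫ G dκ_t x) dμ_{β'} = ∫ G(x) (∫ F dκ_t x) dμ_{β'}` — `P_t` is self-adjoint on `L²(μ_{β'})`.
[cite: ShenZhuZhu2022, §3 (Dirichlet form 𝓔^L and its L²(μ)-semigroup P_t^L, after Lemma 3.3, p. 13)] -/
theorem integral_mul_transition_symm_su2_of_measurable (L : ℕ) [NeZero L] (β' : ℝ)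
    (κ : ℝ≥0 → Kernel (GaugeConfig 3 L (Matrix.specialUnitaryGroup (Fin 2) ℂ))
      (GaugeConfig 3 L (Matrix.specialUnitaryGroup (Fin 2) ℂ))) [∀ t, IsMarkovKernel (κ t)]
    (hreal : ∀ (t : ℝ≥0) (x : GaugeConfig 3 L (Matrix.specialUnitaryGroup (Fin 2) ℂ))
        (Ω : Type) [MeasurableSpace Ω] (P : Measure Ω) [IsProbabilityMeasure P]
        (W : ℝ≥0 → Ω → (Edge 3 L × NoiseIdx 2 → ℝ)) (hW : IsFlatBrownian W P)
        (U : ℝ≥0 → Ω → GaugeConfig 3 L (Matrix.specialUnitaryGroup (Fin 2) ℂ)),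
        (∀ ω, U 0 ω = x) →
        (latticeLangevinDynamics (fundamentalLatticeRep 2) β').IsSolution (fundamentalRep (Fin 2))
          hW.natFiltration P W U →
        κ t x = P.map (U t))
    (t : ℝ≥0) {F G : GaugeConfig 3 L (Matrix.specialUnitaryGroup (Fin 2) ℂ) → ℝ}
    (hFm : Measurable F) (hFb : ∃ C : ℝ, ∀ x, |F x| ≤ C) (hGm : Measurable G) (hGb : ∃ C : ℝ, ∀ x, |G x| ≤ C) :
    ∫ x, F x * (∫ y, G y ∂(κ t x)) ∂(wilsonMeasure (d := 3) (L := L) (fundamentalRep (Fin 2)) β') =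
      ∫ x, G x * (∫ y, F y ∂(κ t x)) ∂(wilsonMeasure (d := 3) (L := L) (fundamentalRep (Fin 2)) β') := by
  classical
  haveI := secondCountableTopology_su2
  haveI := borelSpace_config L
  haveI := polishSpace_config L
  set μ : Measure (GaugeConfig 3 L (Matrix.specialUnitaryGroup (Fin 2) ℂ)) :=
    wilsonMeasure (d := 3) (L := L) (fundamentalRep (Fin 2)) β' with hμ
  haveI : IsProbabilityMeasure μ :=
    isProbabilityMeasure_wilsonMeasure (d := 3) (L := L) (fundamentalRep (Fin 2)) (continuous_fundamentalRep (Fin 2)) β'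
  -- the defect and its antisymmetry
  set D : (GaugeConfig 3 L (Matrix.specialUnitaryGroup (Fin 2) ℂ) → ℝ) →
      (GaugeConfig 3 L (Matrix.specialUnitaryGroup (Fin 2) ℂ) → ℝ) → ℝ := fun F G =>
    (∫ x, F x * (∫ y, G y ∂(κ t x)) ∂μ) - ∫ x, G x * (∫ y, F y ∂(κ t x)) ∂μ with hD
  have hanti : ∀ F G, D G F = -D F G := fun F G => by simp only [hD]; ring
  have hint : ∀ {u : GaugeConfig 3 L (Matrix.specialUnitaryGroup (Fin 2) ℂ) → ℝ} {C : ℝ}, Measurable u → (∀ x, |u x| ≤ C) →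
      Integrable u μ := fun hu hC => (integrable_const _).mono' hu.aestronglyMeasurable
      (ae_of_all _ fun y => by rw [Real.norm_eq_abs]; exact hC y)
  -- step 1: `F₀` bounded measurable with `|F₀| ≤ M`, `G₀` continuous ⇒ `D G₀ F₀ = 0` (approximate `F₀` in `L¹(μ)`)
  have step1 : ∀ {F₀ G₀ : GaugeConfig 3 L (Matrix.specialUnitaryGroup (Fin 2) ℂ) → ℝ}, Measurable F₀ →
      (∃ C : ℝ, ∀ x, |F₀ x| ≤ C) → Continuous G₀ → D G₀ F₀ = 0 := by
    intro F₀ G₀ hF₀m hF₀b hG₀c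
    obtain ⟨MG, -, hMG⟩ := exists_abs_le_of_continuous hG₀c
    obtain ⟨CF, hCF⟩ := hF₀b
    refine abs_eq_zero.1 (le_antisymm (le_of_forall_pos_le_add fun ε hε => ?_) (abs_nonneg _))
    have hMG1 : 0 < 2 * MG + 1 := by linarith [(abs_nonneg _).trans (hMG (Classical.arbitrary _))]
    obtain ⟨g, hg, -⟩ := (hint hF₀m hCF).exists_boundedContinuous_integral_sub_le (μ := μ) (div_pos hε hMG1)
    obtain ⟨Cg, hCg⟩ : ∃ C : ℝ, ∀ x, |g x| ≤ C :=
      ⟨‖g‖, fun x => by rw [← Real.norm_eq_abs]; exact g.norm_coe_le_norm x⟩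
    have hgc : Continuous (g : GaugeConfig 3 L (Matrix.specialUnitaryGroup (Fin 2) ℂ) → ℝ) := g.continuous
    -- `D G₀ g = 0` by the continuous case
    have h0 : D G₀ g = 0 := by
      simp only [hD]
      rw [integral_mul_transition_symm_su2 L β' κ hreal t hG₀c hgc, sub_self]
    have hlip := abs_symmDefect_sub_le (L := L) β' κ hreal t hG₀c.measurable hMG hF₀m ⟨CF, hCF⟩ hgc.measurable ⟨Cg, hCg⟩
    have hlip' : |D G₀ F₀ - D G₀ g| ≤ 2 * MG * ∫ x, |F₀ x - g x| ∂μ := hlip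
    rw [h0, sub_zero] at hlip'
    have hL1 : ∫ x, |F₀ x - g x| ∂μ ≤ ε / (2 * MG + 1) := by
      have : ∫ x, |F₀ x - g x| ∂μ = ∫ x, ‖F₀ x - g x‖ ∂μ :=
        integral_congr_ae (Eventually.of_forall fun x => (Real.norm_eq_abs _).symm)
      rw [this]; exact hg
    have hMG0 : 0 ≤ 2 * MG := by linarith [(abs_nonneg _).trans (hMG (Classical.arbitrary _))]
    calc |D G₀ F₀| ≤ 2 * MG * ∫ x, |F₀ x - g x| ∂μ := hlip'
      _ ≤ 2 * MG * (ε / (2 * MG + 1)) := mul_le_mul_of_nonneg_left hL1 hMG0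
      _ ≤ (2 * MG + 1) * (ε / (2 * MG + 1)) := mul_le_mul_of_nonneg_right (by linarith) (by positivity)
      _ = ε := mul_div_cancel₀ ε hMG1.ne'
      _ ≤ 0 + ε := by rw [zero_add]
  -- step 2: general bounded measurable `F, G` (approximate `G` in `L¹(μ)`)
  obtain ⟨MF, hMF⟩ := hFb
  obtain ⟨CG, hCG⟩ := hGb
  have hgoal : D F G = 0 := by
    refine abs_eq_zero.1 (le_antisymm (le_of_forall_pos_le_add fun ε hε => ?_) (abs_nonneg _))
    have hMF0 : 0 ≤ 2 * MF := by linarith [(abs_nonneg _).trans (hMF (Classical.arbitrary _))]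
    have hMF1 : 0 < 2 * MF + 1 := by linarith
    obtain ⟨g, hg, -⟩ := (hint hGm hCG).exists_boundedContinuous_integral_sub_le (μ := μ) (div_pos hε hMF1)
    obtain ⟨Cg, hCg⟩ : ∃ C : ℝ, ∀ x, |g x| ≤ C :=
      ⟨‖g‖, fun x => by rw [← Real.norm_eq_abs]; exact g.norm_coe_le_norm x⟩
    have hgc : Continuous (g : GaugeConfig 3 L (Matrix.specialUnitaryGroup (Fin 2) ℂ) → ℝ) := g.continuous
    -- `D F g = -D g F = 0` by step 1
    have h0 : D F g = 0 := by
      have h := step1 hFm ⟨MF, hMF⟩ hgc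
      have h' := hanti g F
      rw [h] at h'
      linarith
    have hlip := abs_symmDefect_sub_le (L := L) β' κ hreal t hFm hMF hGm ⟨CG, hCG⟩ hgc.measurable ⟨Cg, hCg⟩
    have hlip' : |D F G - D F g| ≤ 2 * MF * ∫ x, |G x - g x| ∂μ := hlip
    rw [h0, sub_zero] at hlip'
    have hL1 : ∫ x, |G x - g x| ∂μ ≤ ε / (2 * MF + 1) := by
      have : ∫ x, |G x - g x| ∂μ = ∫ x, ‖G x - g x‖ ∂μ :=
        integral_congr_ae (Eventually.of_forall fun x => (Real.norm_eq_abs _).symm)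
      rw [this]; exact hg
    calc |D F G| ≤ 2 * MF * ∫ x, |G x - g x| ∂μ := hlip'
      _ ≤ 2 * MF * (ε / (2 * MF + 1)) := mul_le_mul_of_nonneg_left hL1 hMF0
      _ ≤ (2 * MF + 1) * (ε / (2 * MF + 1)) := mul_le_mul_of_nonneg_right (by linarith) (by positivity)
      _ = ε := mul_div_cancel₀ ε hMF1.ne'
      _ ≤ 0 + ε := by rw [zero_add]
  exact sub_eq_zero.1 hgoal

/-- ★ **Positivity of the SZZ semigroup on `L²(μ_{β'})`**: `∫ F · κ_t F dμ_{β'} = ∫ (κ_{t/2} F)² dμ_{β'} ≥ 0` for continuous `F`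
(Chapman–Kolmogorov `κ_t = κ_{t/2} κ_{t/2}` and detailed balance with the continuous observable `κ_{t/2} F`): `P_t = P_{t/2}* P_{t/2}`.
[cite: ShenZhuZhu2022, §3 (p. 13)] -/
theorem integral_mul_transition_self_eq_sq (L : ℕ) [NeZero L] (β' : ℝ)
    (κ : ℝ≥0 → Kernel (GaugeConfig 3 L (Matrix.specialUnitaryGroup (Fin 2) ℂ))
      (GaugeConfig 3 L (Matrix.specialUnitaryGroup (Fin 2) ℂ))) [∀ t, IsMarkovKernel (κ t)]
    (hreal : ∀ (t : ℝ≥0) (x : GaugeConfig 3 L (Matrix.specialUnitaryGroup (Fin 2) ℂ))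
        (Ω : Type) [MeasurableSpace Ω] (P : Measure Ω) [IsProbabilityMeasure P]
        (W : ℝ≥0 → Ω → (Edge 3 L × NoiseIdx 2 → ℝ)) (hW : IsFlatBrownian W P)
        (U : ℝ≥0 → Ω → GaugeConfig 3 L (Matrix.specialUnitaryGroup (Fin 2) ℂ)),
        (∀ ω, U 0 ω = x) →
        (latticeLangevinDynamics (fundamentalLatticeRep 2) β').IsSolution (fundamentalRep (Fin 2))
          hW.natFiltration P W U →
        κ t x = P.map (U t))
    (s : ℝ≥0) {F : GaugeConfig 3 L (Matrix.specialUnitaryGroup (Fin 2) ℂ) → ℝ} (hF : Continuous F) :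
    ∫ x, F x * (∫ y, F y ∂(κ (s + s) x)) ∂(wilsonMeasure (d := 3) (L := L) (fundamentalRep (Fin 2)) β') =
      ∫ x, (∫ y, F y ∂(κ s x)) ^ 2 ∂(wilsonMeasure (d := 3) (L := L) (fundamentalRep (Fin 2)) β') := by
  classical
  haveI := secondCountableTopology_su2
  haveI := borelSpace_config L
  obtain ⟨M, hM0, hM⟩ := exists_abs_le_of_continuous hF
  -- Chapman–Kolmogorov
  have hCK : κ (s + s) = κ s ∘ₖ κ s := chapmanKolmogorov_szz β' κ hreal s s
  have hFi : ∀ (ν : Measure (GaugeConfig 3 L (Matrix.specialUnitaryGroup (Fin 2) ℂ))) [IsProbabilityMeasure ν],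
      Integrable F ν := fun ν _ =>
    Integrable.of_bound hF.aestronglyMeasurable M (Eventually.of_forall fun z => by rw [Real.norm_eq_abs]; exact hM z)
  have hPF : Continuous fun y => ∫ z, F z ∂(κ s y) := continuous_integral_transitionKernel L β' κ hreal s hF
  have e1 : ∀ x, ∫ y, F y ∂(κ (s + s) x) = ∫ y, (∫ z, F z ∂(κ s y)) ∂(κ s x) := by
    intro x
    haveI : IsProbabilityMeasure ((κ s ∘ₖ κ s) x) := by rw [← hCK]; infer_instance
    rw [hCK]
    exact Kernel.integral_comp (hFi _)
  simp_rw [e1]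
  rw [integral_mul_transition_symm_su2 L β' κ hreal s hF hPF]
  exact integral_congr_ae (Eventually.of_forall fun x => by dsimp only; rw [sq])

/-- ★ **`⟨F, P_t F⟩_{μ_{β'}} ≥ 0`** for continuous `F` and every lattice time `t` (take `s = t/2` in
`integral_mul_transition_self_eq_sq`). [cite: ShenZhuZhu2022, §3 (p. 13)] -/
theorem integral_mul_transition_self_nonneg (L : ℕ) [NeZero L] (β' : ℝ)
    (κ : ℝ≥0 → Kernel (GaugeConfig 3 L (Matrix.specialUnitaryGroup (Fin 2) ℂ))
      (GaugeConfig 3 L (Matrix.specialUnitaryGroup (Fin 2) ℂ))) [∀ t, IsMarkovKernel (κ t)]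
    (hreal : ∀ (t : ℝ≥0) (x : GaugeConfig 3 L (Matrix.specialUnitaryGroup (Fin 2) ℂ))
        (Ω : Type) [MeasurableSpace Ω] (P : Measure Ω) [IsProbabilityMeasure P]
        (W : ℝ≥0 → Ω → (Edge 3 L × NoiseIdx 2 → ℝ)) (hW : IsFlatBrownian W P)
        (U : ℝ≥0 → Ω → GaugeConfig 3 L (Matrix.specialUnitaryGroup (Fin 2) ℂ)),
        (∀ ω, U 0 ω = x) →
        (latticeLangevinDynamics (fundamentalLatticeRep 2) β').IsSolution (fundamentalRep (Fin 2))
          hW.natFiltration P W U →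
        κ t x = P.map (U t))
    (t : ℝ≥0) {F : GaugeConfig 3 L (Matrix.specialUnitaryGroup (Fin 2) ℂ) → ℝ} (hF : Continuous F) :
    0 ≤ ∫ x, F x * (∫ y, F y ∂(κ t x)) ∂(wilsonMeasure (d := 3) (L := L) (fundamentalRep (Fin 2)) β') := by
  have ht : t = t / 2 + t / 2 := (add_halves t).symm
  rw [ht, integral_mul_transition_self_eq_sq L β' κ hreal (t / 2) hF]
  exact integral_nonneg fun x => sq_nonneg _

end Summit.QuantumFields.YangMills.Theorems.ColdStartUniversality

end
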